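import Summits.QuantumFields.YangMills.Theorems.ScalingWindowSplitCurvatureAmnesiaStubUniformOfPointwisePrep
import Summits.QuantumFields.YangMills.Theorems.ScalingWindowSplitCurvatureAmnesiaSchwartzDifferenceQuotient
import HarnessLib

/-!
# The Ward insertion equals the lattice difference-quotient insertion up to `o(1)`
# (crux stmt-QuantumFields-16192, line `WardDefectSketch`, sub-goal (W-exact a1): slot equicontinuity)

Support file for the crux item stmt-QuantumFields-16192 (`CoincidenceRotationBootstrap.CurvatureAmnesia`, shared
verbatim with `ScalingWindowSplit.CurvatureAmnesia`), line `WardDefectSketch`.  Step (W-exact a) of the lattice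
rotation-Ward engine replaces, in ONE slot of the joint Wilson lattice `n`-point function
`LS_k(f) = latticeSchwinger r.ρ sch (·.F) k n σ f` (`YangMillsOS`), the continuum insertion `p · ∂_v fᵢ` by the
LATTICE difference-quotient insertion `p · a_k⁻¹ (fᵢ(· + a_k v) − fᵢ)` (so that summation by parts on `ℤ⁴`
applies).  This file proves the registered sub-goal `latticeSchwinger_update_diffQuotient_tendsto`: under the
lattice TIE (convergence of the complexified `LS_k` on off-diagonal real tensors, `n ≠ 0`), for every real family
`f` with compact, pairwise disjoint supports, every slot `i`, vector `v` and multiplier `p` of temperate growth,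

  `LS_k(f₁, …, p · ∂_v fᵢ, …, f_n) − LS_k(f₁, …, p · a_k⁻¹ (fᵢ(· + a_k v) − fᵢ), …, f_n) ⟶ 0`  (`k → ∞`).

## Proof

* A smooth compactly supported cutoff `χ` with `χ = 1` on the `δ`-thickening of `K = tsupport fᵢ` and
  `tsupport χ` disjoint from every `tsupport fⱼ`, `j ≠ i` (`SlotEquicontinuity.exists_cutoff`: the smooth Urysohn
  lemma `Literature.Analysis.FunctionSpaces.exists_contDiff_one_nhdsSet_of_isCompact` for `K` inside the open
  complement of `⋃_{j ≠ i} tsupport fⱼ`, and `Metric.hasBasis_nhdsSet_thickening`).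
* The slot functionals `L_k(h) = LS_k(f₁, …, χ · h, …, f_n)` are continuous linear forms on `𝓢(ℝ⁴, ℝ)`
  (`exists_multilinearMap_latticeSchwinger`), and the cut-off family is separated for EVERY `h`, so `L_k(h)`
  converges for every `h` by the tie (`exists_tendsto_latticeSchwinger_of_tie`).
* `𝓢(ℝ⁴, ℝ)` is a Fréchet, hence barrelled, space (`Literature.Analysis.FunctionSpaces.barrelledSpace_schwartzMap`),
  so the pointwise bounded sequence `(L_k)` is equicontinuous (Banach–Steinhaus, `WithSeminorms.banach_steinhaus`):
  `L_k(w_k) → 0` whenever `w_k → 0` in `𝓢` (`SlotEquicontinuity.tendsto_apply_of_tendsto_zero`).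
* `w_k = p · ∂_v fᵢ − p · a_k⁻¹ (fᵢ(· + a_k v) − fᵢ) → 0` in `𝓢(ℝ⁴, ℝ)`: the difference quotients converge to the
  directional derivative in the Schwartz topology (`tendsto_diffQuotient_schwartz`, composed with `a_k → 0`,
  `a_k > 0`) and `p ·` is a continuous linear operator (`SchwartzMap.smulLeftCLM`).
* Finally the cutoff is invisible: `χ · (p · ∂_v fᵢ) = p · ∂_v fᵢ` (support inside `K`) and, as soon as
  `‖a_k v‖ < δ`, `χ · (p · a_k⁻¹ (fᵢ(· + a_k v) − fᵢ)) = p · a_k⁻¹ (fᵢ(· + a_k v) − fᵢ)` (support inside the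
  `δ`-thickening of `K`), so `L_k(w_k)` IS the difference in the statement for all large `k`.

Everything is proved; no definitions, no notation.  References: N. Bourbaki, *Espaces vectoriels topologiques*
III §4 (Banach–Steinhaus on barrelled spaces); W. Rudin, *Functional Analysis*, 2nd ed., Thm 2.6 with Thm 7.4 (a);
L. Hörmander, *ALPDO I*, Thm 1.4.1 (smooth cutoffs) — folklore.
-/

noncomputable section

namespace Summit.QuantumFields.YangMills.Cruxes.CurvatureAmnesia.WardDefect

open scoped BigOperators Topology SchwartzMap LineDeriv
open Filter MeasureTheory
open Literature.MathematicalPhysics.QuantumLattice Literature.MathematicalPhysics.AQFT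
  Literature.MathematicalPhysics.QuantumFieldTheory

namespace SlotEquicontinuity

section General

variable {E : Type*} [NormedAddCommGroup E] [NormedSpace ℝ E]

/-- **Equicontinuity at `0` of a pointwise convergent sequence of continuous linear forms on `𝓢(E, ℝ)`.**
If `L k h` converges for every `h` and `w k → 0` in `𝓢(E, ℝ)`, then `L k (w k) → 0`: the `L k` are pointwise
bounded, hence equicontinuous by the Banach–Steinhaus theorem on the barrelled Fréchet space `𝓢(E, ℝ)`
(`Literature.Analysis.FunctionSpaces.barrelledSpace_schwartzMap`, `WithSeminorms.banach_steinhaus`). [folklore] -/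
theorem tendsto_apply_of_tendsto_zero {L : ℕ → 𝓢(E, ℝ) →L[ℝ] ℝ}
    (hL : ∀ h, ∃ c : ℝ, Tendsto (fun k => L k h) atTop (𝓝 c)) {w : ℕ → 𝓢(E, ℝ)}
    (hw : Tendsto w atTop (𝓝 0)) : Tendsto (fun k => L k (w k)) atTop (𝓝 0) := by
  haveI : BarrelledSpace ℝ 𝓢(E, ℝ) := Literature.Analysis.FunctionSpaces.barrelledSpace_schwartzMap
  have hbdd : ∀ h, BddAbove (Set.range fun k => ‖L k h‖) := fun h => by
    obtain ⟨c, hc⟩ := hL h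
    exact hc.norm.bddAbove_range
  have hequi := ((norm_withSeminorms ℝ ℝ).banach_steinhaus (𝓕 := L) fun _ h => by
      simpa only [coe_normSeminorm] using hbdd h).equicontinuous (0 : 𝓢(E, ℝ))
  rw [Metric.equicontinuousAt_iff_right] at hequi
  rw [Metric.tendsto_nhds]
  intro ε hε
  filter_upwards [hw.eventually (hequi ε hε)] with k hk
  have h := hk k
  simp only [Function.comp_apply, map_zero] at h
  rwa [dist_comm] at h

/-- A cutoff `χ` equal to `1` on a set `W` off which `g` vanishes does not change `g`: `χ · g = g`. [folklore] -/
theorem smulLeftCLM_eq_self {χ : E → ℝ} (hχ : χ.HasTemperateGrowth) {W : Set E}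
    (hW : ∀ x ∈ W, χ x = 1) {g : 𝓢(E, ℝ)} (hg : ∀ x, x ∉ W → g x = 0) :
    SchwartzMap.smulLeftCLM ℝ χ g = g := by
  ext x
  rw [SchwartzMap.smulLeftCLM_apply_apply hχ]
  by_cases hx : x ∈ W
  · rw [hW x hx, one_smul]
  · rw [hg x hx, smul_zero]

end General

/-- **A cutoff isolating one slot of a separated family.**  For a real family on `ℝ⁴` with compact, pairwise
disjoint supports and a slot `i` there are a smooth compactly supported `χ` of temperate growth and `δ > 0` with
`χ = 1` on the `δ`-thickening of `tsupport fᵢ` and `tsupport χ` disjoint from `tsupport fⱼ` for every `j ≠ i`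
(smooth Urysohn lemma for the compact `tsupport fᵢ` inside the open complement of the closed
`⋃_{j ≠ i} tsupport fⱼ`; Hörmander, *ALPDO I*, Thm 1.4.1). [folklore] -/
theorem exists_cutoff {n : ℕ} {f : Fin n → 𝓢(EuclideanSpace ℝ (Fin 4), ℝ)}
    (hf : (∀ i, HasCompactSupport (f i : EuclideanSpace ℝ (Fin 4) → ℝ)) ∧
      ∀ i j, i ≠ j → Disjoint (tsupport (f i : EuclideanSpace ℝ (Fin 4) → ℝ))
        (tsupport (f j : EuclideanSpace ℝ (Fin 4) → ℝ))) (i : Fin n) :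
    ∃ (χ : EuclideanSpace ℝ (Fin 4) → ℝ) (δ : ℝ), χ.HasTemperateGrowth ∧
      (∀ j, j ≠ i → Disjoint (tsupport χ) (tsupport (f j : EuclideanSpace ℝ (Fin 4) → ℝ))) ∧ 0 < δ ∧
      ∀ x ∈ Metric.thickening δ (tsupport (f i : EuclideanSpace ℝ (Fin 4) → ℝ)), χ x = 1 := by
  set K : Set (EuclideanSpace ℝ (Fin 4)) := tsupport (f i : EuclideanSpace ℝ (Fin 4) → ℝ)
  have hK : IsCompact K := hf.1 i
  set U : Set (EuclideanSpace ℝ (Fin 4)) :=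
    (⋃ j ∈ Finset.univ.erase i, tsupport (f j : EuclideanSpace ℝ (Fin 4) → ℝ))ᶜ
  have hUo : IsOpen U := (isClosed_biUnion_finset fun j _ => isClosed_tsupport _).isOpen_compl
  have hKU : K ⊆ U := fun x hx hxU => by
    obtain ⟨j, hj, hxj⟩ := Set.mem_iUnion₂.1 hxU
    exact Set.disjoint_left.1 (hf.2 i j (Finset.ne_of_mem_erase hj).symm) hx hxj
  obtain ⟨χ, hχs, hχc, hχU, hχ1, -⟩ :=
    Literature.Analysis.FunctionSpaces.exists_contDiff_one_nhdsSet_of_isCompact hK hUo hKU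
  obtain ⟨δ, hδ, hδ1⟩ := (Metric.hasBasis_nhdsSet_thickening hK).eventually_iff.1 hχ1
  exact ⟨χ, δ, hχc.hasTemperateGrowth hχs, fun j hj => Set.disjoint_left.2 fun x hxχ hxj =>
    hχU hxχ (Set.mem_iUnion₂.2 ⟨j, Finset.mem_erase.2 ⟨hj, Finset.mem_univ j⟩, hxj⟩), hδ,
    fun x hx => hδ1 hx⟩

end SlotEquicontinuity

/-- **(W-exact a1) The Ward insertion equals the lattice difference-quotient insertion up to `o(1)`, under the
tie.**  For a real family `f` with compact, pairwise disjoint supports, a slot `i`, a vector `v` and a multiplier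
`p` of temperate growth, `LS_k(…, p · ∂_v fᵢ, …) − LS_k(…, p · a_k⁻¹ (fᵢ(· + a_k v) − fᵢ), …) → 0`: the slot
functionals `h ↦ LS_k(…, χ · h, …)` (cutoff `χ` of slot `i`) converge pointwise by the tie, hence are
equicontinuous on the Fréchet space `𝓢(ℝ⁴, ℝ)` (Banach–Steinhaus), and the difference quotients converge to
`∂_v fᵢ` in `𝓢(ℝ⁴, ℝ)` (`tendsto_diffQuotient_schwartz`); see the file header. [folklore] -/
theorem latticeSchwinger_update_diffQuotient_tendsto : ∀ (G : Type) [Group G] [TopologicalSpace G] [IsTopologicalGroup G] [CompactSpace G] [MeasurableSpace G] [BorelSpace G] (r : LatticeRep G) (sch : SpeciesScheme (YMSpecies G)) (S : LabelledSchwingerFamily (YMSpecies G) (EuclideanSpace ℝ (Fin 4))), (∀ (n : ℕ), n ≠ 0 → ∀ (σ : Fin n → YMSpecies G) (f : Fin n → 𝓢(EuclideanSpace ℝ (Fin 4), ℝ)) (F : 𝓢((Fin n → EuclideanSpace ℝ (Fin 4)), ℂ)), IsTensorOf F (fun i => ofRealTest (f i)) → IsOffDiagonal F → Tendsto (fun k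 : ℕ => ((latticeSchwinger r.ρ sch (fun s => s.F) k n σ f : ℝ) : ℂ)) atTop (𝓝 (S n σ F))) → ∀ (n : ℕ) (σ : Fin n → YMSpecies G) (f : Fin n → 𝓢(EuclideanSpace ℝ (Fin 4), ℝ)), ((∀ i, HasCompactSupport (f i : EuclideanSpace ℝ (Fin 4) → ℝ)) ∧ ∀ i j, i ≠ j → Disjoint (tsupport (f i : EuclideanSpace ℝ (Fin 4) → ℝ)) (tsupport (f j : EuclideanSpace ℝ (Fin 4) → ℝ))) → ∀ (i : Fin n) (v : EuclideanSpace ℝ (Fin 4)) (p : EuclideanSpace ℝ (Fin 4) → ℝ), Function.HasTemperateGrowth p → Tendsto (fun k : ℕ => latticeSchwinger r.ρ sch (fun s => s.F) k n σ (Function.update f i (SchwartzMap.smulLeftCLM ℝ p (LineDeriv.lineDerivOp v (f i)))) - latticeSchwinger r.ρ sch (fun s => s.F) k n σ (Function.update f i (SchwartzMap.smulLeftCLM ℝ p ((sch.a k)⁻¹ • (translateTest (-(sch.a k • v)) (f i) - f i))))) atTop (𝓝 0) := by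
  intro G _ _ _ _ _ _ r sch S hTie n σ f hf i v p hp
  -- the cutoff of slot `i`
  obtain ⟨χ, δ, hχ, hχd, hδ, hχ1⟩ := SlotEquicontinuity.exists_cutoff hf i
  -- the cut-off families `update f i (χ · h)` are separated for EVERY `h`
  have hsub : ∀ h : 𝓢(EuclideanSpace ℝ (Fin 4), ℝ),
      tsupport ((SchwartzMap.smulLeftCLM ℝ χ h : 𝓢(EuclideanSpace ℝ (Fin 4), ℝ)) :
        EuclideanSpace ℝ (Fin 4) → ℝ) ⊆ tsupport χ := fun h =>
    (SchwartzMap.tsupport_smulLeftCLM_subset χ h).trans Set.inter_subset_right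
  have hsep : ∀ (h : 𝓢(EuclideanSpace ℝ (Fin 4), ℝ)) (a b : Fin n), a ≠ b →
      Disjoint
        (tsupport ((Function.update f i (SchwartzMap.smulLeftCLM ℝ χ h) a :
          𝓢(EuclideanSpace ℝ (Fin 4), ℝ)) : EuclideanSpace ℝ (Fin 4) → ℝ))
        (tsupport ((Function.update f i (SchwartzMap.smulLeftCLM ℝ χ h) b :
          𝓢(EuclideanSpace ℝ (Fin 4), ℝ)) : EuclideanSpace ℝ (Fin 4) → ℝ)) := by
    intro h a b hab
    by_cases ha : a = i
    · subst ha
      rw [Function.update_self, Function.update_of_ne (Ne.symm hab)]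
      exact (hχd b (Ne.symm hab)).mono_left (hsub h)
    · by_cases hb : b = i
      · subst hb
        rw [Function.update_self, Function.update_of_ne ha]
        exact ((hχd a ha).mono_left (hsub h)).symm
      · rw [Function.update_of_ne ha, Function.update_of_ne hb]
        exact hf.2 a b hab
  -- the slot functionals `L k h = LS_k (update f i (χ · h))`, continuous linear forms on `𝓢(ℝ⁴, ℝ)`
  choose T hTc hT using fun k => exists_multilinearMap_latticeSchwinger r sch k σ
  have hcont : ∀ k, Continuous fun h : 𝓢(EuclideanSpace ℝ (Fin 4), ℝ) => T k (Function.update f i h) :=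
    fun k => (hTc k).comp (continuous_const.update i continuous_id)
  set L : ℕ → 𝓢(EuclideanSpace ℝ (Fin 4), ℝ) →L[ℝ] ℝ := fun k =>
    (⟨(T k).toLinearMap f i, hcont k⟩ : 𝓢(EuclideanSpace ℝ (Fin 4), ℝ) →L[ℝ] ℝ).comp
      (SchwartzMap.smulLeftCLM ℝ χ)
  have hL : ∀ k h, L k h = latticeSchwinger r.ρ sch (fun s => s.F) k n σ
      (Function.update f i (SchwartzMap.smulLeftCLM ℝ χ h)) := fun k h => hT k _
  -- pointwise convergence of the slot functionals (the tie, `n ≠ 0` as `i : Fin n`)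
  have hn : n ≠ 0 := (Fin.pos i).ne'
  have hconv : ∀ h, ∃ c : ℝ, Tendsto (fun k => L k h) atTop (𝓝 c) := fun h => by
    simp only [hL]
    exact exists_tendsto_latticeSchwinger_of_tie r sch S hTie hn σ (hsep h)
  -- the difference quotients converge to the directional derivative in `𝓢(ℝ⁴, ℝ)`
  have ha : Tendsto sch.a atTop (𝓝[≠] 0) :=
    tendsto_nhdsWithin_iff.2 ⟨sch.tendsto_a, Eventually.of_forall fun k => (sch.a_pos k).ne'⟩
  have hdq : Tendsto (fun k : ℕ => (sch.a k)⁻¹ • (translateTest (-(sch.a k • v)) (f i) - f i)) atTop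
      (𝓝 (LineDeriv.lineDerivOp v (f i))) :=
    (tendsto_diffQuotient_schwartz (f i) (hf.1 i) v).comp ha
  have hw : Tendsto (fun k : ℕ => SchwartzMap.smulLeftCLM ℝ p (LineDeriv.lineDerivOp v (f i)) -
      SchwartzMap.smulLeftCLM ℝ p ((sch.a k)⁻¹ • (translateTest (-(sch.a k • v)) (f i) - f i)))
      atTop (𝓝 0) := by
    have h := (tendsto_const_nhds (x := SchwartzMap.smulLeftCLM ℝ p (LineDeriv.lineDerivOp v (f i)))).sub
      (((SchwartzMap.smulLeftCLM ℝ p).continuous.tendsto _).comp hdq)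
    rw [sub_self] at h
    exact h
  -- Banach–Steinhaus: `L k (w k) → 0`
  have hmain : Tendsto (fun k : ℕ => L k (SchwartzMap.smulLeftCLM ℝ p (LineDeriv.lineDerivOp v (f i)) -
      SchwartzMap.smulLeftCLM ℝ p ((sch.a k)⁻¹ • (translateTest (-(sch.a k • v)) (f i) - f i))))
      atTop (𝓝 0) :=
    SlotEquicontinuity.tendsto_apply_of_tendsto_zero hconv hw
  -- the cutoff is invisible on the slot-`i` insertions, eventually
  have hsmall : ∀ᶠ k in atTop, ‖sch.a k • v‖ < δ := by
    have h0 : Tendsto (fun k => ‖sch.a k • v‖) atTop (𝓝 0) := by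
      simpa only [zero_smul, norm_zero] using (sch.tendsto_a.smul_const v).norm
    exact (tendsto_order.1 h0).2 δ hδ
  have hout : ∀ x, x ∉ Metric.thickening δ (tsupport (f i : EuclideanSpace ℝ (Fin 4) → ℝ)) →
      x ∉ tsupport (f i : EuclideanSpace ℝ (Fin 4) → ℝ) := fun x hx h =>
    hx (Metric.self_subset_thickening hδ _ h)
  have hfix1 : SchwartzMap.smulLeftCLM ℝ χ (SchwartzMap.smulLeftCLM ℝ p (LineDeriv.lineDerivOp v (f i))) =
      SchwartzMap.smulLeftCLM ℝ p (LineDeriv.lineDerivOp v (f i)) :=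
    SlotEquicontinuity.smulLeftCLM_eq_self hχ hχ1 fun x hx =>
      smulLeftCLM_lineDerivOp_apply_eq_zero (hout x hx) p v
  have hfix2 : ∀ k, ‖sch.a k • v‖ < δ →
      SchwartzMap.smulLeftCLM ℝ χ (SchwartzMap.smulLeftCLM ℝ p
        ((sch.a k)⁻¹ • (translateTest (-(sch.a k • v)) (f i) - f i))) =
      SchwartzMap.smulLeftCLM ℝ p ((sch.a k)⁻¹ • (translateTest (-(sch.a k • v)) (f i) - f i)) := by
    intro k hk
    refine SlotEquicontinuity.smulLeftCLM_eq_self hχ hχ1 fun x hx => ?_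
    have hx0 : f i x = 0 := image_eq_zero_of_notMem_tsupport (hout x hx)
    have hx1 : f i (x - -(sch.a k • v)) = 0 := by
      refine image_eq_zero_of_notMem_tsupport fun h => hx (Metric.mem_thickening_iff.2 ⟨_, h, ?_⟩)
      rwa [dist_eq_norm, sub_sub_cancel, norm_neg]
    rw [SchwartzMap.smulLeftCLM_apply_apply hp, smul_apply, sub_apply,
      translateTest_apply, hx0, hx1, sub_zero, smul_zero, smul_zero]
  refine hmain.congr' ?_
  filter_upwards [hsmall] with k hk
  rw [map_sub, hL, hL, hfix1, hfix2 k hk]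

end Summit.QuantumFields.YangMills.Cruxes.CurvatureAmnesia.WardDefect

end
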